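/-
Copyright (c) 2026 the pub-hodgecm-mathlib formalisation cell (harness21).  Prover seat hodgecm-mathlib-K2E4-p23 (g2), Track B ∕ K2-LIT, h413 =
`stmt-HodgeConjecture-24833`, ENGINE E1, 5Res campaign «ENDGAME BY FAMILIES», ROADCARD §3′ (M2 v2, amendment #2), deal (248) of K2E1-plan (g7): D4′b-2 — the ABSTRACT
PAYER OF THE LETTER `hU` of ★ D5′ ∕ ★ (β): a Gram letter carries a Hecke operator to multiplication by its symbol THROUGH THE GLOBAL MODEL MAP.  Mathlib + ★ P3a + ★ D4′b-1 + ★ modelMap.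
-/
import Summits.HodgeConjecture.HodgeConjecture.Theorems.K2E1ArchCentralSymbolActionU2        -- ★ p860041 (this seat) D4′b-1: `isometry_map_eq_map_isometry`
import Summits.HodgeConjecture.HodgeConjecture.Theorems.K2E1PlancherelModelMapOfIsometry     -- ★ p860498 (K2E4-p10): the global model map `U = U_iso ∘L P_Θ` (`modelMap_apply_of_mem`, `…_eq_zero_of_mem_orthogonal`)
import Mathlib.MeasureTheory.Function.Holder
import Mathlib.MeasureTheory.Function.L2Space
import Mathlib.Analysis.InnerProductSpace.Adjoint
import HarnessLib

/-!
# K2·E1 — `K2E1SymbolActionThroughModelMap`: THE GRAM LETTER `⟪T xᵢ, xⱼ⟫ = ⟪S uᵢ, uⱼ⟫` CARRIES `T` TO `S` THROUGH THE GLOBAL MODEL MAP — `U (T v) = S (U v)` FOR ALL `v`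
# (ROADCARD §3′ D4′b-2: the payer of the letter `hU : U (T_j v) = s_j • U v` of ★ D5′ `K2E1IrreducibleNoContinuousSpectrumU` ∕ ★ (β) `…CMTwoOfLetters`)

Track B ∕ K2-LIT, crux h413 = `stmt-HodgeConjecture-24833`, route of record `HCCMUnconditional`; cell `hodgecm-mathlib`, squad K2, ENGINE E1 (5Res campaign, M2 v2 §3′.1).  Prover seat
`hodgecm-mathlib-K2E4-p23` (g2); deal (248).  THEOREMS ONLY (no `def`, no `instance`, no notation, no named-fact hypothesis, no `sorry`); lane
`--supports stmt-HodgeConjecture-24833 --as helper` (count-neutral).  Abstract Hilbert-space file — no automorphic object.  CLOSES NO SOCKET.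

SETTING (★ P3a ∕ ★ modelMap).  `x : ι → H` (E1: the pseudo-Eisenstein vectors of one family), `u : ι → M` (their models), `Uiso : Θ →ₗᵢ[ℂ] M` on `Θ = closure span {x i}` with `Uiso xᵢ = uᵢ` (★ D4′c),
the GLOBAL model map `U = Uiso ∘L P_Θ : H →L[ℂ] M` (★ p860498, explicit composite).  A Hecke operator `T : H →L H` with `T(Θ) ⊆ Θ` and `T†(Θ) ⊆ Θ` (E1: `Θ_χ` is `R(C_c)`-stable and
`R(h)† = R(h*)`), a symbol operator `S : M →L M` preserving `closure span {u i}`, and THE GRAM LETTER **`hTS : ⟪T xᵢ, xⱼ⟫ = ⟪S uᵢ, uⱼ⟫`** (E1 payer: K2E1-p11 FILE B1∕B2 — the two-term inner-product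
formula with the symbol inserted; SD split form `⟪T xᵢ, xⱼ⟫ = ⟪S₁ rᵢ, rⱼ⟫ + ⟪φ • fᵢ, fⱼ⟫`, §3).
* §1 `map_mem_orthogonal_of_adjoint` (`T(Θᗮ) ⊆ Θᗮ` from `T†(Θ) ⊆ Θ`), **`modelMap_map_eq_map_modelMap`**: `U (T v) = S (U v)` for EVERY `v ∈ H` (on `Θ`: ★ `isometry_map_eq_map_isometry`; on `Θᗮ`:
  both sides vanish).
* §2 `snd_modelMap_map_eq` — product model `M = M₁ ⊕₂ M₂` with `S` DIAGONAL in the second coordinate (`(S m).2 = S₂ m.2`): the second coordinate of `U` intertwines `T` with `S₂`.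
* §3 **`hU_of_gram`** — the ★ (β) letter verbatim: with `S₂ f = φ • f` (★ D1′ Hölder action, `φ : Lp ℂ ∞ m` the axis symbol) and `U_β := snd ∘ U` as a linear map `H →ₗ[ℂ] Lp E 2 m`,
  `U_β (T v) = φ • U_β v` for all `v`; and the SD split-form bridge `gram_of_split` (`⟪S₁ rᵢ, rⱼ⟫ + ⟪φ • fᵢ, fⱼ⟫ = ⟪S uᵢ, uⱼ⟫` for `S = S₁ ⊕ (φ • ·)`).
HONEST LABEL: HC_CM is proved only modulo the 7 printed citations (2 remaining named inputs: hLiu418 = `stmt-HodgeConjecture-24832`, h413 = `stmt-HodgeConjecture-24833`) until rung 0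
closes; this file asserts no named fact and closes no socket; count-neutral.

## References
* [MoeglinWaldspurger1995] C. Mœglin, J.-L. Waldspurger, *Spectral decomposition and Eisenstein series* (1995), II.2.4, VI.2 (the Plancherel isometry intertwines the Hecke action).
* [ReedSimonI1980] M. Reed, B. Simon, *Methods of Modern Mathematical Physics I* (1980), Thm. II.3, §VII.1.
-/

set_option autoImplicit false
-- the mandated namespace repeats the single-problem summit's segment (`HodgeConjecture.HodgeConjecture`)
set_option linter.dupNamespace false

noncomputable section

open Submodule MeasureTheory
open scoped InnerProductSpace ComplexConjugate ENNReal
open Summit.HodgeConjecture.HodgeConjecture.Cruxes.H413.K2E1PlancherelIsometryOfForm (mem_topologicalClosure_span)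
open Summit.HodgeConjecture.HodgeConjecture.Cruxes.H413.K2E1ArchCentralSymbolActionU2 (isometry_map_eq_map_isometry)
open Summit.HodgeConjecture.HodgeConjecture.Cruxes.H413.K2E1PlancherelModelMapOfIsometry

namespace Summit.HodgeConjecture.HodgeConjecture.Cruxes.H413.K2E1SymbolActionThroughModelMap

variable {H M : Type*} [NormedAddCommGroup H] [InnerProductSpace ℂ H] [CompleteSpace H] [NormedAddCommGroup M] [InnerProductSpace ℂ M] {ι : Type*}

/-! ## §1 Through the global model map -/

/-- If `T†` preserves a subspace `Θ` then `T` preserves `Θᗮ`. [folklore] -/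
theorem map_mem_orthogonal_of_adjoint (Θ : Submodule ℂ H) (T : H →L[ℂ] H) (hTadj : ∀ v ∈ Θ, ContinuousLinearMap.adjoint T v ∈ Θ) {w : H} (hw : w ∈ Θᗮ) :
    T w ∈ Θᗮ := by
  rw [Submodule.mem_orthogonal] at hw ⊢
  intro θ hθ
  rw [← ContinuousLinearMap.adjoint_inner_left]
  exact hw _ (hTadj θ hθ)

/-- **THE GRAM LETTER THROUGH THE GLOBAL MODEL MAP**: `U (T v) = S (U v)` for EVERY `v ∈ H`, `U = Uiso ∘L P_Θ` — on `Θ` by ★ `isometry_map_eq_map_isometry`, on `Θᗮ` both sides vanish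
(`T(Θᗮ) ⊆ Θᗮ` since `T†(Θ) ⊆ Θ`).  E1: `U_χ R(h) = M_{σ_h} U_χ` on all of `L²` for arch-central `h`. [cite: MoeglinWaldspurger1995, II.2.4, VI.2] [cite: ReedSimonI1980, Thm. II.3] -/
theorem modelMap_map_eq_map_modelMap (x : ι → H) (u : ι → M) (Uiso : ↥(span ℂ (Set.range x)).topologicalClosure →ₗᵢ[ℂ] M)
    (hUiso : ∀ i, Uiso ⟨x i, mem_topologicalClosure_span x i⟩ = u i)
    (T : H →L[ℂ] H) (hTΘ : ∀ v ∈ (span ℂ (Set.range x)).topologicalClosure, T v ∈ (span ℂ (Set.range x)).topologicalClosure)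
    (hTadjΘ : ∀ v ∈ (span ℂ (Set.range x)).topologicalClosure, ContinuousLinearMap.adjoint T v ∈ (span ℂ (Set.range x)).topologicalClosure)
    (S : M →L[ℂ] M) (hS : ∀ i, S (u i) ∈ (span ℂ (Set.range u)).topologicalClosure) (hTS : ∀ i j, ⟪T (x i), x j⟫_ℂ = ⟪S (u i), u j⟫_ℂ) (v : H) :
    haveI := completeSpace_topologicalClosure_span x
    (Uiso.toContinuousLinearMap.comp (span ℂ (Set.range x)).topologicalClosure.orthogonalProjectionOnto) (T v) =
      S ((Uiso.toContinuousLinearMap.comp (span ℂ (Set.range x)).topologicalClosure.orthogonalProjectionOnto) v) := by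
  haveI := completeSpace_topologicalClosure_span x
  set p : ↥(span ℂ (Set.range x)).topologicalClosure := (span ℂ (Set.range x)).topologicalClosure.orthogonalProjectionOnto v with hp
  -- split `v = p + (v - p)` with `v - p ∈ Θᗮ`
  have hperp : v - (p : H) ∈ ((span ℂ (Set.range x)).topologicalClosure)ᗮ := by
    rw [hp, ← Submodule.starProjection_apply]
    exact Submodule.sub_starProjection_mem_orthogonal v
  have hsplit : T v = T (p : H) + T (v - (p : H)) := by rw [← map_add, add_sub_cancel]
  have hTperp : T (v - (p : H)) ∈ ((span ℂ (Set.range x)).topologicalClosure)ᗮ :=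
    map_mem_orthogonal_of_adjoint _ T hTadjΘ hperp
  have hzero := modelMap_apply_eq_zero_of_mem_orthogonal x Uiso hTperp
  have hon : (Uiso.toContinuousLinearMap.comp (span ℂ (Set.range x)).topologicalClosure.orthogonalProjectionOnto) (T (p : H)) =
      Uiso ⟨T (p : H), hTΘ _ p.2⟩ := modelMap_apply_of_mem x Uiso ⟨T (p : H), hTΘ _ p.2⟩
  have hv : (Uiso.toContinuousLinearMap.comp (span ℂ (Set.range x)).topologicalClosure.orthogonalProjectionOnto) v = Uiso p := rfl
  calc (Uiso.toContinuousLinearMap.comp (span ℂ (Set.range x)).topologicalClosure.orthogonalProjectionOnto) (T v)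
      = (Uiso.toContinuousLinearMap.comp (span ℂ (Set.range x)).topologicalClosure.orthogonalProjectionOnto) (T (p : H)) +
          (Uiso.toContinuousLinearMap.comp (span ℂ (Set.range x)).topologicalClosure.orthogonalProjectionOnto) (T (v - (p : H))) := by
        rw [hsplit, map_add]
    _ = Uiso ⟨T (p : H), hTΘ _ p.2⟩ := by rw [hon, hzero, add_zero]
    _ = S (Uiso p) := isometry_map_eq_map_isometry Uiso hUiso T hTΘ S hS hTS p
    _ = S ((Uiso.toContinuousLinearMap.comp (span ℂ (Set.range x)).topologicalClosure.orthogonalProjectionOnto) v) := by rw [hv]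

/-! ## §2 Product models: the second coordinate -/

/-- **SECOND COORDINATE OF A DIAGONAL SYMBOL OPERATOR** (`M = M₁ ⊕₂ M₂`, `(S m).2 = S₂ m.2`): the second coordinate of the global model map intertwines `T` with `S₂`.
E1 (SD families): `M₁` = the residue atoms, `M₂ = L²((0,∞); W)` the line, `S₂` = multiplication by the axis symbol. [cite: MoeglinWaldspurger1995, VI.2] -/
theorem snd_modelMap_map_eq {M₁ M₂ : Type*} [NormedAddCommGroup M₁] [InnerProductSpace ℂ M₁] [NormedAddCommGroup M₂] [InnerProductSpace ℂ M₂]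
    (x : ι → H) (u : ι → WithLp 2 (M₁ × M₂)) (Uiso : ↥(span ℂ (Set.range x)).topologicalClosure →ₗᵢ[ℂ] WithLp 2 (M₁ × M₂))
    (hUiso : ∀ i, Uiso ⟨x i, mem_topologicalClosure_span x i⟩ = u i)
    (T : H →L[ℂ] H) (hTΘ : ∀ v ∈ (span ℂ (Set.range x)).topologicalClosure, T v ∈ (span ℂ (Set.range x)).topologicalClosure)
    (hTadjΘ : ∀ v ∈ (span ℂ (Set.range x)).topologicalClosure, ContinuousLinearMap.adjoint T v ∈ (span ℂ (Set.range x)).topologicalClosure)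
    (S : WithLp 2 (M₁ × M₂) →L[ℂ] WithLp 2 (M₁ × M₂)) (hS : ∀ i, S (u i) ∈ (span ℂ (Set.range u)).topologicalClosure) (hTS : ∀ i j, ⟪T (x i), x j⟫_ℂ = ⟪S (u i), u j⟫_ℂ)
    (S₂ : M₂ →L[ℂ] M₂) (hSdiag : ∀ m : WithLp 2 (M₁ × M₂), (WithLp.ofLp (S m)).2 = S₂ (WithLp.ofLp m).2) (v : H) :
    haveI := completeSpace_topologicalClosure_span x
    (WithLp.ofLp ((Uiso.toContinuousLinearMap.comp (span ℂ (Set.range x)).topologicalClosure.orthogonalProjectionOnto) (T v))).2 =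
      S₂ (WithLp.ofLp ((Uiso.toContinuousLinearMap.comp (span ℂ (Set.range x)).topologicalClosure.orthogonalProjectionOnto) v)).2 := by
  rw [modelMap_map_eq_map_modelMap x u Uiso hUiso T hTΘ hTadjΘ S hS hTS v, hSdiag]

/-! ## §3 The ★ (β) letter `hU` verbatim, and the SD split-form Gram bridge -/

omit [CompleteSpace H] in
/-- **THE SD SPLIT-FORM GRAM BRIDGE**: for the diagonal symbol operator `S (toLp (r, f)) = toLp (S₁ r, φ • f)` on `M₁ ⊕₂ L²`, the split Gram letter `⟪T xᵢ, xⱼ⟫ = ⟪S₁ rᵢ, rⱼ⟫ + ⟪φ • fᵢ, fⱼ⟫`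
is the Gram letter `⟪T xᵢ, xⱼ⟫ = ⟪S uᵢ, uⱼ⟫` with `uᵢ = toLp (rᵢ, fᵢ)`. [folklore] -/
theorem gram_of_split {M₁ : Type*} [NormedAddCommGroup M₁] [InnerProductSpace ℂ M₁]
    {Ω : Type*} {mΩ : MeasurableSpace Ω} {m : Measure Ω} {E : Type*} [NormedAddCommGroup E] [InnerProductSpace ℂ E] [ENNReal.HolderTriple ∞ 2 2]
    (x : ι → H) (r : ι → M₁) (f : ι → Lp E 2 m) (T : H →L[ℂ] H) (S₁ : M₁ →L[ℂ] M₁) (φ : Lp ℂ ∞ m)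
    (S : WithLp 2 (M₁ × Lp E 2 m) →L[ℂ] WithLp 2 (M₁ × Lp E 2 m)) (hSdef : ∀ p : WithLp 2 (M₁ × Lp E 2 m), S p = WithLp.toLp 2 (S₁ (WithLp.ofLp p).1, (φ • (WithLp.ofLp p).2 : Lp E 2 m)))
    (hTS' : ∀ i j, ⟪T (x i), x j⟫_ℂ = ⟪S₁ (r i), r j⟫_ℂ + ⟪(φ • f i : Lp E 2 m), f j⟫_ℂ) (i j : ι) :
    ⟪T (x i), x j⟫_ℂ = ⟪S (WithLp.toLp 2 (r i, f i)), WithLp.toLp 2 (r j, f j)⟫_ℂ := by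
  rw [hTS', hSdef, WithLp.prod_inner_apply]

/-- **`hU` OF ★ (β) VERBATIM FROM THE GRAM LETTER**: with the diagonal symbol operator `S` (`(S m).2 = φ • m.2`) on `M₁ ⊕₂ L²(Ω; E)` and `U_β := snd ∘ (Uiso ∘ P_Θ)` as a linear map
`H →ₗ[ℂ] Lp E 2 m`: `U_β (T v) = φ • U_β v` for ALL `v` (so in particular on `V_P`).  E1: `φ = (hs).toLp (t ↦ ŝ_h(½ + i t))`. [cite: MoeglinWaldspurger1995, VI.2] -/
theorem hU_of_gram {M₁ : Type*} [NormedAddCommGroup M₁] [InnerProductSpace ℂ M₁]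
    {Ω : Type*} {mΩ : MeasurableSpace Ω} {m : Measure Ω} {E : Type*} [NormedAddCommGroup E] [InnerProductSpace ℂ E] [ENNReal.HolderTriple ∞ 2 2]
    (x : ι → H) (u : ι → WithLp 2 (M₁ × Lp E 2 m)) (Uiso : ↥(span ℂ (Set.range x)).topologicalClosure →ₗᵢ[ℂ] WithLp 2 (M₁ × Lp E 2 m))
    (hUiso : ∀ i, Uiso ⟨x i, mem_topologicalClosure_span x i⟩ = u i)
    (T : H →L[ℂ] H) (hTΘ : ∀ v ∈ (span ℂ (Set.range x)).topologicalClosure, T v ∈ (span ℂ (Set.range x)).topologicalClosure)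
    (hTadjΘ : ∀ v ∈ (span ℂ (Set.range x)).topologicalClosure, ContinuousLinearMap.adjoint T v ∈ (span ℂ (Set.range x)).topologicalClosure)
    (S : WithLp 2 (M₁ × Lp E 2 m) →L[ℂ] WithLp 2 (M₁ × Lp E 2 m)) (hS : ∀ i, S (u i) ∈ (span ℂ (Set.range u)).topologicalClosure)
    (hTS : ∀ i j, ⟪T (x i), x j⟫_ℂ = ⟪S (u i), u j⟫_ℂ)
    (φ : Lp ℂ ∞ m) (hSdiag : ∀ p : WithLp 2 (M₁ × Lp E 2 m), (WithLp.ofLp (S p)).2 = (φ • (WithLp.ofLp p).2 : Lp E 2 m)) (v : H) :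
    haveI := completeSpace_topologicalClosure_span x
    ((LinearMap.snd ℂ M₁ (Lp E 2 m)).comp ((WithLp.linearEquiv 2 ℂ (M₁ × Lp E 2 m)).toLinearMap.comp
        (Uiso.toContinuousLinearMap.comp (span ℂ (Set.range x)).topologicalClosure.orthogonalProjectionOnto).toLinearMap)) (T v) =
      (φ • ((LinearMap.snd ℂ M₁ (Lp E 2 m)).comp ((WithLp.linearEquiv 2 ℂ (M₁ × Lp E 2 m)).toLinearMap.comp
        (Uiso.toContinuousLinearMap.comp (span ℂ (Set.range x)).topologicalClosure.orthogonalProjectionOnto).toLinearMap)) v : Lp E 2 m) := by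
  haveI := completeSpace_topologicalClosure_span x
  have h := modelMap_map_eq_map_modelMap x u Uiso hUiso T hTΘ hTadjΘ S hS hTS v
  change (WithLp.ofLp ((Uiso.toContinuousLinearMap.comp (span ℂ (Set.range x)).topologicalClosure.orthogonalProjectionOnto) (T v))).2 =
    (φ • (WithLp.ofLp ((Uiso.toContinuousLinearMap.comp (span ℂ (Set.range x)).topologicalClosure.orthogonalProjectionOnto) v)).2 : Lp E 2 m)
  rw [h, hSdiag]

end Summit.HodgeConjecture.HodgeConjecture.Cruxes.H413.K2E1SymbolActionThroughModelMap

end
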